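import Literature.NumberTheory.EllipticCurves.Kato2004.IwasawaH1LambdaTorsionFreeProofs
import Literature.NumberTheory.EllipticCurves.KatoRankBoundProofs
import Literature.NumberTheory.EllipticCurves.IwasawaAlgebra
import Mathlib.RingTheory.Length
import Mathlib.RingTheory.PowerSeries.NoZeroDivisors
import HarnessLib

/-!
# Crux `DerivedKatoDoor` (stmt-BirchSwinnertonDyer-23024), line `lower`: the ALGEBRA stub
# `stub_depthLeQuotientLength` — «`T^k ∣ p^m · z₀` in `𝐇¹_Γ(T_pW)` forces `k ≤ ℓ_T(𝐇¹/Λz₀)`»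

Route `DerivedKatoValuationDoor` (BSD is not proved by any of this). Registered stub of the lead's line
`Cruxes/DerivedKatoDoor/Lines/lower.lean` (composition `DerivedKatoDoor_of`: `v_T(z₀) ≤ ℓ_T(𝐇¹/Λz₀) ≤
ℓ_T(X₀(E/ℚ_∞)) ≤ 1`), proved here for EVERY elliptic `W/ℚ`, prime `p`, `ℤ_p`-extension datum `K`,
topological generator `γ`, pinned datum `I : Kato2004.IwasawaH1Data W p K γ` and non-zero `z₀ ∈ I.H`:

  `p^m · z₀ = T^k · h` for some `h ∈ 𝐇¹`, `m ∈ ℕ`  ⟹  `k ≤ ℓ_T(𝐇¹/Λz₀)`,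

where `Λ = ℤ_p⟦T⟧` (`IwasawaAlgebra p`, `T = PowerSeries.X`), `𝔭_T = (T)` (`IwasawaAlgebra.primeT p`) and
`ℓ_T(M) = length_{Λ_(T)} M_(T)` (`Module.lengthAt`). Mathematics (Kato, Astérisque 295, Thm. 12.4 (2):
`𝐇¹` is `Λ`-torsion-free — the tree THEOREM `IwasawaH1Data.noZeroSMulDivisors`, proved for every pinned
datum; the rest is discrete-valuation-ring algebra at `(T)`): in `(𝐇¹/Λz₀)_(T)` the classes of
`h, T h, …, T^k h` span a strictly decreasing chain `Λ_(T)[h] ⊋ Λ_(T)[T h] ⊋ ⋯ ⊋ Λ_(T)[T^k h]` — if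
`[T^j h] ∈ Λ_(T)[T^{j+1} h]` (`j < k`) then, clearing denominators `u, t ∉ (T)` and multiplying by `p^m`,
`(p^m u a T^{j+1} − p^m u t T^j − b T^k) · h = 0` for some `a, b ∈ Λ`, so (torsion-freeness, `h ≠ 0`,
`Λ` a domain) `p^m u t = T · (p^m u a − b T^{k−j−1})`, and the prime `T` would divide one of `p^m, u, t` —
it divides none. A chain of length `k` below `⊤` gives `k ≤ height ⊤ = length`. No finite generation
and no rank statement about `𝐇¹` is used.

References: K. Kato, Astérisque 295 (2004), Thm. 12.4 (2) (p. 221), §13.8 (p. 228) [Kato2004Asterisque];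
L. Washington, *Introduction to Cyclotomic Fields*, §13.2 (lengths of `Λ`-modules at height-one primes)
[Washington1997]; tree: `Kato2004/IwasawaH1LambdaTorsionFreeProofs.lean` (`IwasawaH1Data.noZeroSMulDivisors`),
`IwasawaAlgebra.lean` (`Module.lengthAt`), `KatoRankBoundProofs.lean` (`IwasawaAlgebra.primeT`).
-/

-- D-0017: single-problem summit, so `Summit.BirchSwinnertonDyer.BirchSwinnertonDyer.…` repeats a
-- namespace BY DESIGN.
set_option linter.dupNamespace false

noncomputable section

namespace Summit.BirchSwinnertonDyer.BirchSwinnertonDyer.Theorems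

open Literature.NumberTheory.EllipticCurves Literature.NumberTheory.EllipticCurves.Kato2004

/-! ## The DVR algebra at a prime `(π)` of a domain -/

section Algebra

variable {R : Type*} [CommRing R] [IsDomain R] {M : Type*} [AddCommGroup M] [Module R M]
  [NoZeroSMulDivisors R M]

/-- **Key cancellation.** In a torsion-free module over a domain, with `π` prime, `q, u, t` prime to
`π`, `h ≠ 0` and `j < k`: the relation `(u a π^{j+1}) • h − (u t π^j) • h = b • z` together with
`q • z = π^k • h` is impossible. (Multiply by `q`, cancel `h` and `π^j`: `π ∣ q u t`.) [folklore] -/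
theorem not_rel_of_prime_pow {π q u t a b : R} {j k : ℕ} (hπ : Prime π) (hq : ¬ π ∣ q) (hu : ¬ π ∣ u)
    (ht : ¬ π ∣ t) {z h : M} (hh : h ≠ 0) (hz : q • z = π ^ k • h) (hjk : j < k)
    (hrel : (u * (a * π ^ (j + 1))) • h - (u * (t * π ^ j)) • h = b • z) : False := by
  -- multiply the relation by `q`, rewrite `q • z`, collect everything on `h`
  have e1 : q • ((u * (a * π ^ (j + 1))) • h - (u * (t * π ^ j)) • h) = b • (q • z) := by
    rw [hrel, smul_smul, smul_smul, mul_comm q b]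
  rw [hz, smul_sub, smul_smul, smul_smul, smul_smul] at e1
  have h2 : (q * (u * (a * π ^ (j + 1))) - q * (u * (t * π ^ j)) - b * π ^ k) • h = 0 := by
    rw [sub_smul, sub_smul, e1, sub_self]
  have h3 : q * (u * (a * π ^ (j + 1))) - q * (u * (t * π ^ j)) - b * π ^ k = 0 :=
    (smul_eq_zero.mp h2).resolve_right hh
  -- `π^j · (q u a π − q u t − b π^{d+1}) = 0` with `k = j + 1 + d`, so the cofactor vanishes
  obtain ⟨d, hd⟩ : ∃ d, k = j + 1 + d := ⟨k - (j + 1), by omega⟩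
  have h4 : π ^ j * (q * (u * a) * π - q * (u * t) - b * π ^ (d + 1)) = 0 := by
    rw [← h3, hd]; ring
  have h5 : q * (u * a) * π - q * (u * t) - b * π ^ (d + 1) = 0 :=
    (mul_eq_zero.mp h4).resolve_left (pow_ne_zero _ hπ.ne_zero)
  -- hence `π ∣ q (u t)`
  have h6 : π ∣ q * (u * t) :=
    ⟨q * (u * a) - b * π ^ d, by linear_combination -h5⟩
  rcases hπ.dvd_or_dvd h6 with h7 | h7
  · exact hq h7
  · rcases hπ.dvd_or_dvd h7 with h8 | h8
    · exact hu h8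
    · exact ht h8

end Algebra

/-! ## Lengths at `(T)` of `𝐇¹/Λz₀` -/

section Length

variable {p : ℕ} [Fact p.Prime]

/-- `T ∤ p^m` in `Λ = ℤ_p⟦T⟧` (the constant coefficient `p^m` is non-zero). [folklore] -/
theorem not_X_dvd_natCast_pow (m : ℕ) :
    ¬ (PowerSeries.X : IwasawaAlgebra p) ∣ ((p : IwasawaAlgebra p) ^ m) := by
  rw [PowerSeries.X_dvd_iff, map_pow, map_natCast]
  exact pow_ne_zero _ (Nat.cast_ne_zero.mpr (Fact.out : p.Prime).ne_zero)

/-- Elements of the complement of `𝔭_T = (T)` are not divisible by `T`. [folklore] -/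
theorem not_X_dvd_of_mem_primeCompl {u : IwasawaAlgebra p}
    (hu : u ∈ (IwasawaAlgebra.primeT p).asIdeal.primeCompl) :
    ¬ (PowerSeries.X : IwasawaAlgebra p) ∣ u := by
  intro h
  exact hu (by rw [IwasawaAlgebra.primeT_asIdeal]; exact Ideal.mem_span_singleton.mpr h)

variable {M : Type*} [AddCommGroup M] [Module (IwasawaAlgebra p) M]
  [NoZeroSMulDivisors (IwasawaAlgebra p) M]

/-- **The DVR chain.** For a torsion-free `Λ`-module `M`, `z ≠ 0` and `q • z = T^k • h` with `T ∤ q`: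
in the localisation of `M/Λz` at `(T)` the span of the class of `T^j h` STRICTLY contains the span of
the class of `T^{j+1} h`, for every `j < k`. [cite: Washington1997, §13.2] -/
theorem span_succ_lt_span {q : IwasawaAlgebra p} (hq : ¬ (PowerSeries.X : IwasawaAlgebra p) ∣ q)
    {z h : M} (hz0 : z ≠ 0) {j k : ℕ} (hz : q • z = (PowerSeries.X : IwasawaAlgebra p) ^ k • h)
    (hjk : j < k) :
    Submodule.span (Localization.AtPrime (IwasawaAlgebra.primeT p).asIdeal)
        {LocalizedModule.mk (S := (IwasawaAlgebra.primeT p).asIdeal.primeCompl)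
          (Submodule.Quotient.mk (p := Submodule.span (IwasawaAlgebra p) {z})
            ((PowerSeries.X : IwasawaAlgebra p) ^ (j + 1) • h)) 1} <
      Submodule.span (Localization.AtPrime (IwasawaAlgebra.primeT p).asIdeal)
        {LocalizedModule.mk (S := (IwasawaAlgebra.primeT p).asIdeal.primeCompl)
          (Submodule.Quotient.mk (p := Submodule.span (IwasawaAlgebra p) {z})
            ((PowerSeries.X : IwasawaAlgebra p) ^ j • h)) 1} := by
  set Λ := IwasawaAlgebra p
  set P := (IwasawaAlgebra.primeT p).asIdeal
  set T : Λ := PowerSeries.X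
  set N := M ⧸ Submodule.span Λ {z}
  -- `h ≠ 0`
  have hh : h ≠ 0 := by
    rintro rfl
    rw [smul_zero] at hz
    rcases smul_eq_zero.mp hz with hq0 | hz'
    · exact hq (hq0 ▸ dvd_zero _)
    · exact hz0 hz'
  refine lt_of_le_of_ne ?_ ?_
  · -- `[T^{j+1} h] = T • [T^j h]`
    rw [Submodule.span_singleton_le_iff_mem]
    have : LocalizedModule.mk (S := P.primeCompl) (Submodule.Quotient.mk (p := Submodule.span Λ {z})
          (T ^ (j + 1) • h)) 1 =
        (algebraMap Λ (Localization.AtPrime P) T) •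
          LocalizedModule.mk (S := P.primeCompl)
            (Submodule.Quotient.mk (p := Submodule.span Λ {z}) (T ^ j • h)) 1 := by
      rw [← Localization.mk_one_eq_algebraMap, LocalizedModule.mk_smul_mk, one_mul,
        ← Submodule.Quotient.mk_smul, smul_smul, ← pow_succ']
    rw [this]
    exact Submodule.smul_mem _ _ (Submodule.subset_span rfl)
  · -- `[T^j h] ∉ Λ_(T) · [T^{j+1} h]`
    intro heq
    have hmem : LocalizedModule.mk (S := P.primeCompl)
        (Submodule.Quotient.mk (p := Submodule.span Λ {z}) (T ^ j • h)) 1 ∈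
        Submodule.span (Localization.AtPrime P)
          {LocalizedModule.mk (S := P.primeCompl)
            (Submodule.Quotient.mk (p := Submodule.span Λ {z}) (T ^ (j + 1) • h)) 1} := by
      rw [heq]; exact Submodule.subset_span rfl
    rw [Submodule.mem_span_singleton] at hmem
    obtain ⟨c, hc⟩ := hmem
    induction c using Localization.induction_on with
    | H y =>
      obtain ⟨a, t⟩ := y
      rw [LocalizedModule.mk_smul_mk, mul_one, LocalizedModule.mk_eq] at hc
      obtain ⟨u, hu⟩ := hc
      -- `u • 1 • [a • T^{j+1} h] = u • t • [T^j h]` in `N`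
      simp only [one_smul, Submonoid.smul_def, ← Submodule.Quotient.mk_smul, smul_smul] at hu
      rw [Submodule.Quotient.eq, Submodule.mem_span_singleton] at hu
      obtain ⟨b, hb⟩ := hu
      exact not_rel_of_prime_pow (M := M) (a := a) (b := b) PowerSeries.X_prime hq
        (not_X_dvd_of_mem_primeCompl u.2) (not_X_dvd_of_mem_primeCompl t.2) hh hz hjk hb.symm

/-- **`k ≤ ℓ_T(M/Λz)`** for a torsion-free `Λ`-module `M`, `z ≠ 0` and `q • z = T^k • h` with `T ∤ q`
(the chain of `span_succ_lt_span` has length `k` below `⊤`). [cite: Washington1997, §13.2] -/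
theorem le_lengthAt_quotient_of_smul_eq_pow_smul {q : IwasawaAlgebra p}
    (hq : ¬ (PowerSeries.X : IwasawaAlgebra p) ∣ q) {z h : M} (hz0 : z ≠ 0) {k : ℕ}
    (hz : q • z = (PowerSeries.X : IwasawaAlgebra p) ^ k • h) :
    (k : ℕ∞) ≤ Literature.NumberTheory.EllipticCurves.Module.lengthAt (IwasawaAlgebra p)
      (M ⧸ Submodule.span (IwasawaAlgebra p) {z}) (IwasawaAlgebra.primeT p) := by
  set Λ := IwasawaAlgebra p
  set P := (IwasawaAlgebra.primeT p).asIdeal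
  -- the chain `F j = Λ_(T) · [T^j h]`
  let F : ℕ → Submodule (Localization.AtPrime P)
      (LocalizedModule P.primeCompl (M ⧸ Submodule.span Λ {z})) := fun j =>
    Submodule.span (Localization.AtPrime P)
      {LocalizedModule.mk (S := P.primeCompl)
        (Submodule.Quotient.mk (p := Submodule.span Λ {z}) ((PowerSeries.X : Λ) ^ j • h)) 1}
  have hlt : ∀ j, j < k → F (j + 1) < F j := fun j hj => span_succ_lt_span hq hz0 hz hj
  -- `i ≤ height (F (k - i))` for `i ≤ k`
  have hchain : ∀ i, i ≤ k → (i : ℕ∞) ≤ Order.height (F (k - i)) := by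
    intro i
    induction i with
    | zero => intro _; simp
    | succ i ih =>
      intro hi
      have h1 := ih (by omega)
      have h2 : F (k - i) < F (k - (i + 1)) := by
        have : k - i = (k - (i + 1)) + 1 := by omega
        rw [this]
        exact hlt _ (by omega)
      calc ((i + 1 : ℕ) : ℕ∞) = (i : ℕ∞) + 1 := by push_cast; rfl
        _ ≤ Order.height (F (k - i)) + 1 := add_le_add h1 le_rfl
        _ ≤ Order.height (F (k - (i + 1))) := Order.height_add_one_le h2
  have hk := hchain k le_rfl
  rw [Nat.sub_self] at hk
  unfold Literature.NumberTheory.EllipticCurves.Module.lengthAt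
  rw [Module.length_eq_height]
  exact hk.trans (Order.height_mono le_top)

end Length

/-! ## The registered stub -/

/-- **Stub L1 of line `lower` of crux `DerivedKatoDoor` (stmt-BirchSwinnertonDyer-23024) —
`stub_depthLeQuotientLength`, PROVED for every pinned datum.** For `W/ℚ` elliptic, `p` prime, a
`ℤ_p`-extension datum `K` with topological generator `γ`, `I : Kato2004.IwasawaH1Data W p K γ` and a
NON-ZERO `z₀ ∈ 𝐇¹ = I.H`: if `p^m · z₀ = T^k · h` for some `h ∈ 𝐇¹` and `m ∈ ℕ` («`T^k ∣ z₀` rationally»),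
then `k ≤ ℓ_T(𝐇¹/Λz₀) = length_{Λ_(T)} (𝐇¹/Λz₀)_(T)`. Proof: `𝐇¹` has no `Λ`-zero-divisors
(`IwasawaH1Data.noZeroSMulDivisors`, Kato Thm. 12.4 (2), a tree theorem), `T ∤ p^m`, and
`le_lengthAt_quotient_of_smul_eq_pow_smul`. The registered signature, verbatim.
[cite: Kato2004Asterisque, Thm. 12.4 (2) (p. 221)] [cite: Washington1997, §13.2] -/
theorem stub_depthLeQuotientLength :
    ∀ (W : WeierstrassCurve ℚ) [W.IsElliptic] (p : ℕ) [Fact p.Prime]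
      [ContinuousSMul ℤ_[p] (W.tateModule p)]
      (K : Literature.NumberTheory.EllipticCurves.ZpExtension ℚ p) (γ : Field.absoluteGaloisGroup ℚ)
      (I : Literature.NumberTheory.EllipticCurves.Kato2004.IwasawaH1Data W p K γ) (z₀ : I.H),
      K.IsTopGenerator γ → z₀ ≠ 0 → ∀ k : ℕ,
      (∃ (h : I.H) (m : ℕ),
        ((p : Literature.NumberTheory.EllipticCurves.IwasawaAlgebra p) ^ m) • z₀ =
          ((PowerSeries.X : Literature.NumberTheory.EllipticCurves.IwasawaAlgebra p) ^ k) • h) →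
      (k : ℕ∞) ≤ Literature.NumberTheory.EllipticCurves.Module.lengthAt
        (Literature.NumberTheory.EllipticCurves.IwasawaAlgebra p)
        (I.H ⧸ Submodule.span (Literature.NumberTheory.EllipticCurves.IwasawaAlgebra p) {z₀})
        (Literature.NumberTheory.EllipticCurves.IwasawaAlgebra.primeT p) := by
  intro W _ p _ _ K γ I z₀ hγ hz0 k ⟨h, m, hdiv⟩
  haveI := I.noZeroSMulDivisors hγ
  exact le_lengthAt_quotient_of_smul_eq_pow_smul (not_X_dvd_natCast_pow m) hz0 hdiv

end Summit.BirchSwinnertonDyer.BirchSwinnertonDyer.Theorems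

end
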